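import Literature.NumberTheory.LFunctions.AutomaticSequenceBaseChange
import Literature.NumberTheory.LFunctions.AutomaticSequenceTransducerGroup
import HarnessLib

/-!
# The transducer of the power automaton (Müllner 2017, Prop. 2.25, second step: minimal images agree; proved)

Everything in this file is PROVED. For the `p`-th power `powδ k p δ` of a base-`k` automaton
(`AutomaticSequenceBaseChange.lean`; base `K = k^p`, the letter `D < K` acting as the block
`(D)_k^p`), read with the letters `≥ K` acting trivially (`digitRestrict`), we compare the
naturally induced transducer with that of `δ` (letters `≥ k` trivial):

* `wordAct_powK` — a base-`K` digit word acts as the concatenation of its blocks;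
  `exists_blocks_of_length_dvd` — every base-`k` digit word of length divisible by `p` is such a
  concatenation;
* `minRank_powK_eq` — `n₀` is the same for both automata (pad a minimising word on the left with
  zeros to a length divisible by `p`);
* `minImages_powK_eq` — `S(A)` is the same Finset for both automata (Müllner, proof of Prop. 2.25:
  the transducer of the power automaton lives on the same minimal images); hence the state types
  are equivalent (`minImageEquivPow`).

The identification of the outputs `T` through this equivalence and the consequences
`d = k₀ = 1` for `p = d(A) k₀(A)` (the group half of Prop. 2.25) are not formalised here.

## References
* C. Müllner, Duke Math. J. 166 (2017), Prop. 2.25 (proof). [Mullner2017]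
-/

noncomputable section

open Finset

namespace Literature.NumberTheory.LFunctions

section PowK

variable {σ : Type*}

/-- Reading a base-`k^p` digit word with the (digit-restricted) power automaton = reading the
concatenation of the blocks with `δ`. [cite: Mullner2017, Prop. 2.25 (proof)] -/
theorem wordAct_powK (k p : ℕ) (δ : σ → ℕ → σ) {W : List ℕ} (hW : ∀ D ∈ W, D < k ^ p) (q : σ) :
    wordAct (digitRestrict (k ^ p) (powδ k p δ)) W q = wordAct δ (W.map (msbBlock k p)).flatten q := by
  rw [wordAct_digitRestrict _ hW, wordAct_def, foldl_powδ]

/-- The letters of the blocks of base-`k^p` digits are base-`k` digits. [folklore] -/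
theorem digits_flatten_map_msbBlock {k p : ℕ} (hk : 1 < k) (W : List ℕ) :
    ∀ d ∈ (W.map (msbBlock k p)).flatten, d < k := by
  intro d hd
  rw [List.mem_flatten] at hd
  obtain ⟨l, hl, hdl⟩ := hd
  obtain ⟨D, -, rfl⟩ := List.mem_map.1 hl
  exact lt_of_mem_msbBlock hk hdl

/-- The length of the concatenation of the blocks. [folklore] -/
theorem length_flatten_map_msbBlock {k p : ℕ} (hk : 1 < k) {W : List ℕ} (hW : ∀ D ∈ W, D < k ^ p) :
    (W.map (msbBlock k p)).flatten.length = p * W.length := by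
  induction W with
  | nil => simp
  | cons D W ih =>
    rw [List.map_cons, List.flatten_cons, List.length_append, ih (fun x hx => hW x (by simp [hx])),
      length_msbBlock hk (hW D (by simp)), List.length_cons]
    ring

/-- **Every base-`k` digit word of length divisible by `p` is a concatenation of blocks** of
base-`k^p` digits (split off the first `p` letters). [folklore] -/
theorem exists_blocks_of_length_dvd {k p : ℕ} (hk : 1 < k) (hp : 0 < p) (n : ℕ) :
    ∀ (v : List ℕ), v.length = n → (∀ d ∈ v, d < k) → p ∣ n →
      ∃ W : List ℕ, (∀ D ∈ W, D < k ^ p) ∧ (W.map (msbBlock k p)).flatten = v := by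
  induction n using Nat.strong_induction_on with
  | _ n ih =>
    intro v hvl hvd hpn
    rcases Nat.eq_zero_or_pos n with rfl | hnpos
    · rw [List.length_eq_zero_iff] at hvl
      subst hvl
      exact ⟨[], by simp, by simp⟩
    · have hpn' : p ≤ n := Nat.le_of_dvd hnpos hpn
      set c := v.take p with hc
      set v' := v.drop p with hv'
      have hcv : c ++ v' = v := List.take_append_drop p v
      have hcl : c.length = p := by rw [hc, List.length_take]; omega
      have hv'l : v'.length = n - p := by rw [hv', List.length_drop, hvl]
      have hcd : ∀ d ∈ c, d < k := fun d hd => hvd d (List.mem_of_mem_take hd)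
      have hv'd : ∀ d ∈ v', d < k := fun d hd => hvd d (List.mem_of_mem_drop hd)
      obtain ⟨W', hW'd, hW'⟩ := ih (n - p) (by omega) v' hv'l hv'd (Nat.dvd_sub hpn dvd_rfl)
      have hD : Nat.ofDigits k c.reverse < k ^ p := by
        rw [← hcl, ← List.length_reverse]
        exact Nat.ofDigits_lt_base_pow_length hk fun d hd => hcd d (List.mem_reverse.1 hd)
      have hblock : msbBlock k p (Nat.ofDigits k c.reverse) = c := by
        rw [← hcl]; exact msbBlock_ofDigits_reverse hk hcd
      refine ⟨Nat.ofDigits k c.reverse :: W', fun x hx => ?_, ?_⟩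
      · rcases List.mem_cons.1 hx with rfl | h
        · exact hD
        · exact hW'd x h
      · rw [List.map_cons, List.flatten_cons, hblock, hW', hcv]

variable [Fintype σ] [DecidableEq σ]

/-- `δ(σ, W)` for the power automaton is `δ(σ, blocks of W)`. [cite: Mullner2017, Prop. 2.25 (proof)] -/
theorem fullImage_powK (k p : ℕ) (δ : σ → ℕ → σ) {W : List ℕ} (hW : ∀ D ∈ W, D < k ^ p) :
    fullImage (digitRestrict (k ^ p) (powδ k p δ)) W = fullImage δ (W.map (msbBlock k p)).flatten :=
  image_congr fun q _ => wordAct_powK k p δ hW q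

/-- **`n₀` of the power automaton equals `n₀` of the automaton** (letters `≥ k` trivial on `δ`).
[cite: Mullner2017, Prop. 2.25 (proof)] -/
theorem minRank_powK_eq {k p : ℕ} (hk : 2 ≤ k) (hp : 0 < p) (δ : σ → ℕ → σ)
    (htriv : ∀ q d, k ≤ d → δ q d = q) :
    minRank (digitRestrict (k ^ p) (powδ k p δ)) = minRank δ := by
  have hk1 : 1 < k := hk
  have htrivK := digitRestrict_trivial (k ^ p) (powδ k p δ)
  apply le_antisymm
  · -- pad a minimising digit word of `δ` on the left to a length divisible by `p`
    obtain ⟨w₁, h₁⟩ := exists_card_fullImage_eq_minRank δ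
    set w := w₁.filter (· < k) with hw
    have hwd : ∀ d ∈ w, d < k := fun d hd => mem_filter_lt hd
    have hw₁ : fullImage δ w = fullImage δ w₁ := MinImage.fullImage_filter htriv w₁
    set j := (p - 1) * w.length with hj
    have hlen : p ∣ (List.replicate j 0 ++ w).length := by
      refine ⟨w.length, ?_⟩
      rw [List.length_append, List.length_replicate, hj, Nat.sub_mul, one_mul,
        Nat.sub_add_cancel (Nat.le_mul_of_pos_left _ hp)]
    obtain ⟨W, hWd, hW⟩ := exists_blocks_of_length_dvd hk1 hp _ (List.replicate j 0 ++ w) rfl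
      (fun d hd => by
        rcases List.mem_append.1 hd with h | h
        · rw [List.eq_of_mem_replicate h]; omega
        · exact hwd d h) hlen
    calc minRank (digitRestrict (k ^ p) (powδ k p δ))
        ≤ (fullImage (digitRestrict (k ^ p) (powδ k p δ)) W).card := minRank_le_card_fullImage _ W
      _ = (fullImage δ (List.replicate j 0 ++ w)).card := by rw [fullImage_powK k p δ hWd, hW]
      _ ≤ (fullImage δ w).card := card_le_card (fullImage_append_subset δ _ w)
      _ = minRank δ := by rw [hw₁, h₁]
  · obtain ⟨W₁, h₁⟩ := exists_card_fullImage_eq_minRank (digitRestrict (k ^ p) (powδ k p δ))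
    set W := W₁.filter (· < k ^ p) with hW
    have hWd : ∀ D ∈ W, D < k ^ p := fun D hD => mem_filter_lt hD
    rw [← h₁, ← MinImage.fullImage_filter htrivK W₁, ← hW, fullImage_powK k p δ hWd]
    exact minRank_le_card_fullImage δ _

/-- **`S(A)` of the power automaton equals `S(A)` of the automaton** (Müllner, proof of Prop. 2.25).
[cite: Mullner2017, Prop. 2.25 (proof)] -/
theorem minImages_powK_eq {k p : ℕ} (hk : 2 ≤ k) (hp : 0 < p) (δ : σ → ℕ → σ)
    (htriv : ∀ q d, k ≤ d → δ q d = q) :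
    minImages (digitRestrict (k ^ p) (powδ k p δ)) = minImages δ := by
  have hk1 : 1 < k := hk
  have htrivK := digitRestrict_trivial (k ^ p) (powδ k p δ)
  have hrank := minRank_powK_eq hk hp δ htriv
  ext M
  rw [mem_minImages, mem_minImages, hrank]
  constructor
  · rintro ⟨hcard, W₁, rfl⟩
    refine ⟨by rw [hcard], (W₁.filter (· < k ^ p)).map (msbBlock k p) |>.flatten, ?_⟩
    rw [← fullImage_powK k p δ (fun D hD => mem_filter_lt hD), MinImage.fullImage_filter htrivK]
  · rintro ⟨hcard, w₁, rfl⟩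
    set w := w₁.filter (· < k) with hw
    have hwd : ∀ d ∈ w, d < k := fun d hd => mem_filter_lt hd
    have hw₁ : fullImage δ w = fullImage δ w₁ := MinImage.fullImage_filter htriv w₁
    set j := (p - 1) * w.length with hj
    have hlen : p ∣ (List.replicate j 0 ++ w).length := by
      refine ⟨w.length, ?_⟩
      rw [List.length_append, List.length_replicate, hj, Nat.sub_mul, one_mul,
        Nat.sub_add_cancel (Nat.le_mul_of_pos_left _ hp)]
    obtain ⟨W, hWd, hW⟩ := exists_blocks_of_length_dvd hk1 hp _ (List.replicate j 0 ++ w) rfl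
      (fun d hd => by
        rcases List.mem_append.1 hd with h | h
        · rw [List.eq_of_mem_replicate h]; omega
        · exact hwd d h) hlen
    -- the padded word has the same (minimal) image
    have heq : fullImage δ (List.replicate j 0 ++ w) = fullImage δ w₁ :=
      eq_of_subset_of_card_le (hw₁ ▸ fullImage_append_subset δ _ w)
        (by rw [hcard]; exact (minRank_le_card_fullImage δ _))
    refine ⟨hcard, W, ?_⟩
    rw [fullImage_powK k p δ hWd, hW, heq]

/-- The state types of the two transducers are equivalent (same minimal images).
[cite: Mullner2017, Prop. 2.25 (proof)] -/
def minImageEquivPow {k p : ℕ} (hk : 2 ≤ k) (hp : 0 < p) (δ : σ → ℕ → σ)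
    (htriv : ∀ q d, k ≤ d → δ q d = q) :
    MinImage (digitRestrict (k ^ p) (powδ k p δ)) ≃ MinImage δ :=
  Equiv.subtypeEquivRight fun M => by rw [minImages_powK_eq hk hp δ htriv]

end PowK

end Literature.NumberTheory.LFunctions
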